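/-
Copyright (c) 2026. All rights reserved.
Released under Apache 2.0 license as described in the file LICENSE.
Authors: abc-iut cell, seat abc-iut-L6-t6 (gen 5; junction row «J-Fmod», L6-lead §F v1.19g — the L6↔L1 dictionary).
-/
import Literature.AlgebraicGeometry.Frobenioids.ArithmeticFrobenioidModel
import Literature.IUT.LogThetaLattice.GlobalLGPFrobenioidsModFrak
import HarnessLib

/-!
# [IUTchIII] Example 3.6 (ii) at a number field: the EFFECTIVE families `{D_v ∈ Γ_v^{≥0}}_v` ARE the effective
# arithmetic divisors `Φ(F)` of [FrdI] Example 6.3 — the divisor-MONOID level of abc-iut-w4-d005's dictionary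

S. Mochizuki, *Inter-universal Teichmüller Theory III*, kurims manuscript (May 2020), Example 3.6 (ii) p. 108
([IUTchIII] Ex 3.6 (ii) p.108) [claim: Mochizuki2012, status: disputed]: "by associating to an object
`𝔍 = {𝔍_v}_{v∈𝕍}` … the arithmetic line bundle on `S_mod` obtained from the trivial arithmetic line bundle … by
modifying the integral structure … at `v ∈ 𝕍` in the fashion prescribed by `𝔍_v`"; *The geometry of Frobenioids I*,
Example 6.3 p. 113: "`Φ(F) = ⊕_{v ∈ V(F)} ord(𝒪_v^▷)` … `Φ(F)^gp = ⊕_{v ∈ V(F)} ord(F_v)`" [cite: MochizukiFrdI2008, Ex. 6.3 p.113].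

abc-iut-w4-d005 (`GlobalLGPFrobenioidsModFrak.lean`) proved the dictionary at the GROUP level:
`Prop37.frakObjEquiv : FrakObj (Places F) (Gamma F) ≃+ ArithDivisor F` (`Γ_v = ℤ` at finite, `ℝ` at archimedean
`v`), with `frakObjEquiv_nonneg_iff` (effective ↔ nonnegative coordinates) and `frakObjEquiv_betaDiv`
(`(β_v(f))_v ↦ div(f)`).  This file (constructions + theorems; no `Prop`-valued named fact) descends it to the
DIVISOR MONOIDS that [FrdI] Thm 5.2 model Frobenioids are built from — abc-iut-L6-t6's `Φ(∗) = EffDiv` (the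
`AddSubmonoid` `effDiv` of effective families, written multiplicatively) and abc-iut-L1's
`EffArithDivisor F = (FinitePlace F →₀ ℕ) × (InfinitePlace F → ℝ≥0)`:
* `Prop37.effArithDivisorOf` / **`Prop37.effDivHom : EffDiv (Places F) (Gamma F) (nonneg F) →* Multiplicative (EffArithDivisor F)`**,
  refining `frakObjEquiv` along `Φ ⊆ Φ^gp` (`toArithDivisor_effArithDivisorOf`), **bijective** (`effDivHom_bijective`);
* `gpMap_effDivHom_toGp` — compatibility of the groupifications: under `(effDivHom)^gp`, L6-t6's class map
  `toGp : ⊕_v Γ_v → Φ(∗)^gp` corresponds to L1's `Φ(F)^gp ≅ ArithDivisor F` (`EffArithDivisor.gpEquiv`) ∘ `frakObjEquiv`.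
Consumer: the junction `GlobalFrobenioid.Fmod ≌ Prop37.FmodModel F` (`GlobalFrobenioidsFmodJunction.lean`).
Nothing here asserts a disputed claim or takes a side on [IUTchIII] Cor. 3.12 (typed ≠ discharged).
-/

noncomputable section

namespace Literature.IUT.LogThetaLattice

namespace Prop37

open Function GlobalFrobenioidModels Literature.AlgebraicGeometry.Frobenioids

section Dictionary

variable (F : Type) [Field F] [NumberField F]

/-- An EFFECTIVE family `{D_v ∈ Γ_v^{≥0}}_v` of the integral number-field datum (abc-iut-L6-t6's `effDiv` at
`Γ_v = ℤ, ℝ`) as an effective arithmetic divisor of `F` ([FrdI] Ex 6.3: `ℤ_{≥0}`-coefficients at the finite,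
`ℝ_{≥0}` at the archimedean places) — abc-iut-w4-d005's dictionary `frakObjEquiv` on the effective cone.
([IUTchIII] Ex 3.6 (ii) p.108) [claim: Mochizuki2012, status: disputed] -/
def effArithDivisorOf (J : effDiv (Places F) (Gamma F) (nonneg F)) : EffArithDivisor F :=
  ((frakObjEquiv F (J : FrakObj (Places F) (Gamma F))).1.mapRange Int.toNat (by simp),
    fun v => ⟨(frakObjEquiv F (J : FrakObj (Places F) (Gamma F))).2 v, by
      rw [frakObjEquiv_snd]
      exact (mem_nonneg_inl F v _).mp (J.2 (.inl v))⟩)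

/-- The dictionary on the effective cone refines `frakObjEquiv`: `Φ(F) ⊆ Φ(F)^gp`.
([IUTchIII] Ex 3.6 (ii) p.108) [claim: Mochizuki2012, status: disputed] -/
theorem toArithDivisor_effArithDivisorOf (J : effDiv (Places F) (Gamma F) (nonneg F)) :
    EffArithDivisor.toArithDivisor F (effArithDivisorOf F J) =
      frakObjEquiv F (J : FrakObj (Places F) (Gamma F)) := by
  refine Prod.ext (Finsupp.ext fun w => ?_) (funext fun v => ?_)
  · rw [EffArithDivisor.toArithDivisor_fst]
    change ((Int.toNat ((frakObjEquiv F (J : FrakObj (Places F) (Gamma F))).1 w) : ℕ) : ℤ) =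
      (frakObjEquiv F (J : FrakObj (Places F) (Gamma F))).1 w
    rw [Int.toNat_of_nonneg]
    rw [frakObjEquiv_fst]
    exact (mem_nonneg_inr F w _).mp (J.2 (.inr w))
  · rw [EffArithDivisor.toArithDivisor_snd]
    rfl

/-- Additivity of the effective dictionary. ([IUTchIII] Ex 3.6 (ii) p.108) [claim: Mochizuki2012, status: disputed] -/
theorem effArithDivisorOf_add (J J' : effDiv (Places F) (Gamma F) (nonneg F)) :
    effArithDivisorOf F (J + J') = effArithDivisorOf F J + effArithDivisorOf F J' :=
  EffArithDivisor.toArithDivisor_injective F (by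
    rw [map_add, toArithDivisor_effArithDivisorOf, toArithDivisor_effArithDivisorOf,
      toArithDivisor_effArithDivisorOf, AddSubmonoid.coe_add, map_add])

/-- The effective dictionary at `0`. ([IUTchIII] Ex 3.6 (ii) p.108) [claim: Mochizuki2012, status: disputed] -/
theorem effArithDivisorOf_zero : effArithDivisorOf F 0 = 0 :=
  EffArithDivisor.toArithDivisor_injective F (by
    rw [toArithDivisor_effArithDivisorOf, AddSubmonoid.coe_zero, map_zero, map_zero])

/-- **The effective dictionary as a homomorphism of (multiplicative) monoids `Φ(∗) → Φ(F)`** — L6's divisor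
monoid of `𝓕⊛_𝔪𝔬𝔡` to L1's [FrdI] Ex 6.3 divisor monoid at `F`. ([IUTchIII] Ex 3.6 (ii) p.108) [claim: Mochizuki2012, status: disputed] -/
def effDivHom : EffDiv (Places F) (Gamma F) (nonneg F) →* Multiplicative (EffArithDivisor F) :=
  AddMonoidHom.toMultiplicative
    { toFun := effArithDivisorOf F
      map_zero' := effArithDivisorOf_zero F
      map_add' := effArithDivisorOf_add F }

/-- `effDivHom` on elements. ([IUTchIII] Ex 3.6 (ii) p.108) [claim: Mochizuki2012, status: disputed] -/
theorem effDivHom_apply (x : EffDiv (Places F) (Gamma F) (nonneg F)) :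
    effDivHom F x = Multiplicative.ofAdd (effArithDivisorOf F (Multiplicative.toAdd x)) := rfl

/-- **The effective dictionary is bijective.** ([IUTchIII] Ex 3.6 (ii) p.108) [claim: Mochizuki2012, status: disputed] -/
theorem effDivHom_bijective : Bijective (effDivHom F) := by
  constructor
  · intro x y hxy
    have h1 : effArithDivisorOf F (Multiplicative.toAdd x) = effArithDivisorOf F (Multiplicative.toAdd y) :=
      congrArg Multiplicative.toAdd hxy
    have h2 := congrArg (EffArithDivisor.toArithDivisor F) h1
    rw [toArithDivisor_effArithDivisorOf, toArithDivisor_effArithDivisorOf] at h2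
    exact congrArg Multiplicative.ofAdd (Subtype.ext ((frakObjEquiv F).injective h2))
  · intro D
    let J : FrakObj (Places F) (Gamma F) :=
      (frakObjEquiv F).symm (EffArithDivisor.toArithDivisor F (Multiplicative.toAdd D))
    have hJ : J ∈ effDiv (Places F) (Gamma F) (nonneg F) := by
      rw [mem_effDiv, frakObjEquiv_nonneg_iff, AddEquiv.apply_symm_apply]
      exact ⟨fun w => by rw [EffArithDivisor.toArithDivisor_fst]; exact Int.natCast_nonneg _,
        fun v => by rw [EffArithDivisor.toArithDivisor_snd]; exact NNReal.coe_nonneg _⟩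
    refine ⟨Multiplicative.ofAdd ⟨J, hJ⟩, ?_⟩
    apply Multiplicative.toAdd.injective
    apply EffArithDivisor.toArithDivisor_injective F
    rw [effDivHom_apply, toAdd_ofAdd, toAdd_ofAdd, toArithDivisor_effArithDivisorOf]
    exact AddEquiv.apply_symm_apply _ _

/-- **Compatibility of the groupifications**: under the effective dictionary, L6-t6's class map
`toGp : ⊕_v Γ_v → Φ(∗)^gp` corresponds to L1's `Φ(F)^gp ≅ ArithDivisor F` (`EffArithDivisor.gpEquiv`) composed
with `frakObjEquiv` — `(effDivHom)^gp (toGp [𝔍]) = gpEquiv⁻¹ (frakObjEquiv 𝔍)`.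
([IUTchIII] Ex 3.6 (ii) p.108) [claim: Mochizuki2012, status: disputed] -/
theorem gpMap_effDivHom_toGp (J : FrakObj (Places F) (Gamma F)) :
    MonGp.map (effDivHom F) (toGp (modelHyps F) (Multiplicative.ofAdd J)) =
      (EffArithDivisor.gpEquiv F).symm (Multiplicative.ofAdd (frakObjEquiv F J)) := by
  apply (EffArithDivisor.gpEquiv F).injective
  rw [MulEquiv.apply_symm_apply, EffArithDivisor.gpEquiv_apply, toGp_ofAdd, toGpFun, map_div, MonGp.map_of,
    MonGp.map_of, map_div, EffArithDivisor.gpHom_of, EffArithDivisor.gpHom_of, effDivHom_apply, effDivHom_apply,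
    toAdd_ofAdd, toAdd_ofAdd, toAdd_ofAdd, toAdd_ofAdd, toArithDivisor_effArithDivisorOf,
    toArithDivisor_effArithDivisorOf, ← ofAdd_sub, ← map_sub]
  exact congrArg (fun D => Multiplicative.ofAdd (frakObjEquiv F D)) (posPart_sub_negPart (modelHyps F) J)

end Dictionary

end Prop37

end Literature.IUT.LogThetaLattice

end
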